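import Summits.NavierStokesRegularity.NavierStokesRegularity.Theses.LevelSetModeration
import HarnessLib

/-!
# Line `pressure-free-split` — skeleton of the crux `HighSpeedPressureWork`
# (route LevelSetModeration, item stmt-NavierStokesRegularity-18149; strategist alternative line)

The crux: for every `ν, T > 0` there are `m < 10/3` and a modulus `F` such that every classical
Leray–Hopf solution on `ℝ³ × [0,T)` from a rapidly decaying datum with `∫|u₀|² ≤ E₀`, `|u₀| ≤ B₀`
satisfies, for `M ≥ 2B₀`, `c ∈ [M/2, M]`, `t < T`,
`PW_c(t) := −∫₀ᵗ∫ (1−c/|u|)₊ ∇p̃·u ≤ √(F(E₀,B₀) M^m V_c(T)) · √(D_c(T))`,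
`V_c(T) = ∫₀ᵀ |{|u|>c}|`, `D_c(T) = ∫₀ᵀ∫ 1_{|u|>c} |∇|u||²`.

LINE. Dotting the momentum equation with the Lipschitz, compactly supported multiplier
`(1 − c/|u|)₊ u` and integrating over `ℝ³ × (0,t)` gives the EXACT level-set balance
(Vasseur 2007, Lemma 11, globalised; the tree's `LevelSetEnergyInequality` is its lower half)

  `PW_c(t) = ½ ∫ (|u(t)| − c)₊² + ν D̃_c(t)`,
  `D̃_c(t) = ∫₀ᵗ∫ 1_{|u|>c} [ (c/|u|) |∇|u||² + (1 − c/|u|) |∇u|²_F ]`     (for `c ≥ sup |u₀|`),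

so the pressure work on a high-speed set IS the excess kinetic energy of the speed above the level
plus the (moderated) viscous loss on the set: the pressure — and with it every gauge / moderator /
per-component-constant subtlety of the pairing — drops out identically. The crux is therefore the
conjunction of two PRESSURE-FREE class laws, one per nonnegative summand:

* `stub_pressureFreeBound` (S0, TRUE, M): the upper half of the balance,
  `PW_c(t) ≤ ½∫(|u(t)|−c)₊² + ν D̃_c(t)` for `c ≥ sup|u₀|` (equality in fact; the tree proves the
  lower half `½∫(|u(t)|−c)₊² + ν D_c(t) ≤ PW_c(t)` in `…LevelSetEnergyInequality*.lean`, dropping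
  `(1−c/|u|)(|∇u|²_F − |∇|u||²) ≥ 0` and passing `h → 1_A` by dominated convergence — the same files
  give the equality).
* `stub_viscousLevelSetLaw` (S1, OPEN — level-set Caccioppoli law): `ν D̃_c(t) ≤ ½√(F M^m V_c(T)) √(D_c(T))`,
  i.e. `ν² D̃_c (D̃_c/D_c) ≤ ¼ F M^m V_c`: the moderated gradient energy of the fast fluid is
  controlled by `M^m ×` the space–time measure of the fast set — a reverse-Poincaré inequality for
  the speed on its own super-level sets (the disprover's §4 "cleaner target"; scaling gives `m = 4`).
* `stub_kineticLevelSetLaw` (S2, OPEN — no-flash law): `½∫(|u(t)|−c)₊² ≤ ½√(F M^m V_c(T)) √(D_c(T))`: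
  a speed excursion above `c` cannot be simultaneously fat (large excess energy at one instant) and
  brief/gradient-poor (small occupation × speed-gradient energy).
* `HighSpeedPressureWork_of`: the crux BY NAME from the three stubs (real proof: pure algebra at the
  common exponent `max(m₁,m₂)`, modulus `max(F₁,F₂,0)`).

Both laws are consequences of the crux (each summand is `≤ PW`), so `{S1, S2}` is a faithful split,
not a strengthening. EXPONENT-MONOTONE PHRASING of S1/S2 ("some `m₀ < 10/3` such that every exponent
`m ∈ [m₀, 10/3)` has a modulus"): for `B₀ > 0` it is equivalent to the single-exponent law (the
floor `M ≥ 2B₀` bounds `M^{m₀−m} ≤ (2B₀)^{m₀−m}`, absorbed by `F`), for `B₀ ≤ 0` the solution is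
the rest state; it lets the two halves be glued at a common exponent without a degenerate-data case
analysis.
-/

set_option linter.dupNamespace false

noncomputable section

open MeasureTheory Set Filter Topology
open scoped ENNReal

namespace Summit.NavierStokesRegularity.NavierStokesRegularity.Cruxes.HighSpeedPressureWork.PressureFreeSplit

open Literature.Analysis.FluidPDE
open Summit.NavierStokesRegularity.NavierStokesRegularity.Theses.LevelSetModeration

/-- **STUB S0 (M, true) — pressure-free upper bound (upper half of the exact level-set balance).**
For a classical solution on `[0,T)` that is Leray–Hopf on `[0,T]` from a rapidly decaying datum,
a level `c > 0` with `|u₀| ≤ c`, and `t < T`: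
`−∫₀ᵗ∫ (1−c/|u|)₊ ∇p̃·u ≤ ½∫(|u(t)|−c)₊² + ν ∫₀ᵗ∫ 1_{|u|>c}[(c/|u|)|∇|u||² + (1−c/|u|)|∇u|²_F]`.
Mechanism: dot NS with `(1−c/|u|)₊u` (Tao-class slab regularity makes every pairing `L¹`),
transport integrates to zero (`transport_slice`), time balance (`truncSq_balance`, the `t = 0`
term vanishes since `|u₀| ≤ c`), `∇p = ∇p̃` a.e. in time (`tao_pressure_normalisation_holds`), and
the viscous identity `∫(1−c/|u|)₊⟪Δu,u⟫ = −∫1_{|u|>c}[(1−c/|u|)|∇u|²_F + (c/|u|)|∇|u||²]`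
(regularised `viscous_step` + dominated convergence, keeping the term the tree's inequality drops).
The moderated dissipation is finite (`≤ ∫₀ᵗ∫|∇u|²_F < ∞`, Leray–Hopf), so `toReal` is honest. -/
theorem stub_pressureFreeBound :
    ∀ (ν T : ℝ) (u : ℝ → EuclideanSpace ℝ (Fin 3) → EuclideanSpace ℝ (Fin 3))
      (p : ℝ → EuclideanSpace ℝ (Fin 3) → ℝ), 0 < ν → 0 < T →
      Literature.Analysis.FluidPDE.IsClassicalNSSolutionOn (Set.Ico 0 T) ν 0 u p →
      Literature.Analysis.FluidPDE.IsLerayHopfOn T ν 0 (u 0) u →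
      Literature.Analysis.FluidPDE.HasRapidSpatialDecay (u 0) →
      ∀ (c : ℝ), 0 < c → (∀ x, ‖u 0 x‖ ≤ c) → ∀ t ∈ Set.Ico 0 T,
        -(∫ τ in Set.Ioo 0 t, ∫ x, max (1 - c / ‖u τ x‖) 0 *
            (fderiv ℝ (Literature.Analysis.FluidPDE.normalisedPressure (u τ)) x (u τ x))) ≤
          1 / 2 * (∫ x, (max (‖u t x‖ - c) 0) ^ 2) +
            ν * (∫⁻ τ in Set.Ioo 0 t, ∫⁻ x, Set.indicator {x | c < ‖u τ x‖}
              (fun x => ENNReal.ofReal (c / ‖u τ x‖ * ‖fderiv ℝ (fun y => ‖u τ y‖) x‖ ^ 2 +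
                (1 - c / ‖u τ x‖) *
                  Literature.Analysis.FluidPDE.frobeniusNormSq (fderiv ℝ (u τ) x))) x).toReal := by
  sorry

/-- **STUB S1 (OPEN — the viscous half; level-set Caccioppoli law).** For every `ν, T > 0` there is
`m₀ < 10/3` such that for every exponent `m ∈ [m₀, 10/3)` some modulus `F` makes every classical
Leray–Hopf solution from a rapidly decaying datum with `∫|u₀|² ≤ E₀`, `|u₀| ≤ B₀` satisfy, for all
`M ≥ 2B₀`, `c ∈ [M/2, M]`, `c > 0`, `t < T`:
`ν ∫₀ᵗ∫ 1_{|u|>c}[(c/|u|)|∇|u||² + (1−c/|u|)|∇u|²_F] ≤ ½ √(F(E₀,B₀) M^m V_c(T)) √(D_c(T))`.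
Equivalently `ν² D̃_c · (D̃_c/D_c) ≤ ¼ F M^m V_c`: the gradient energy of the fast fluid is at most
`M^m ×` its space–time occupation (dimensional bookkeeping gives `m = 4`; the De Giorgi threshold
is `10/3`). A consequence of the crux (`ν D̃_c(t) ≤ PW_c(t)` by the exact balance). Why it might
fail: only along a family with unbounded amplification `M/B₀` at fixed `(E₀,B₀,ν,T)` (thin fast
sheets/tubes at the viscous scale `ν/M`), i.e. the blow-up regime — regularity-strength. -/
theorem stub_viscousLevelSetLaw :
    ∀ (ν T : ℝ), 0 < ν → 0 < T → ∃ m₀ : ℝ, m₀ < 10 / 3 ∧ ∀ m : ℝ, m₀ ≤ m → m < 10 / 3 →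
      ∃ F : ℝ → ℝ → ℝ,
      ∀ (u : ℝ → EuclideanSpace ℝ (Fin 3) → EuclideanSpace ℝ (Fin 3))
        (p : ℝ → EuclideanSpace ℝ (Fin 3) → ℝ),
        Literature.Analysis.FluidPDE.IsClassicalNSSolutionOn (Set.Ico 0 T) ν 0 u p →
        Literature.Analysis.FluidPDE.IsLerayHopfOn T ν 0 (u 0) u →
        Literature.Analysis.FluidPDE.HasRapidSpatialDecay (u 0) →
        ∀ (E₀ B₀ : ℝ), (∫ x, ‖u 0 x‖ ^ 2) ≤ E₀ → (∀ x, ‖u 0 x‖ ≤ B₀) →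
        ∀ (M c t : ℝ), 2 * B₀ ≤ M → M / 2 ≤ c → c ≤ M → 0 < c → t ∈ Set.Ico 0 T →
        ν * (∫⁻ τ in Set.Ioo 0 t, ∫⁻ x, Set.indicator {x | c < ‖u τ x‖}
              (fun x => ENNReal.ofReal (c / ‖u τ x‖ * ‖fderiv ℝ (fun y => ‖u τ y‖) x‖ ^ 2 +
                (1 - c / ‖u τ x‖) *
                  Literature.Analysis.FluidPDE.frobeniusNormSq (fderiv ℝ (u τ) x))) x).toReal ≤
          Real.sqrt (F E₀ B₀ * M ^ m *
              (∫⁻ τ in Set.Ioo 0 T, volume {x | c < ‖u τ x‖}).toReal) / 2 *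
            Real.sqrt ((∫⁻ τ in Set.Ioo 0 T, ∫⁻ x, Set.indicator {x | c < ‖u τ x‖}
              (fun x => ENNReal.ofReal (‖fderiv ℝ (fun y => ‖u τ y‖) x‖ ^ 2)) x).toReal) := by
  sorry

/-- **STUB S2 (OPEN — the kinetic half; no-flash law).** Same quantifiers as S1; conclusion
`½ ∫ (|u(t)|−c)₊² ≤ ½ √(F(E₀,B₀) M^m V_c(T)) √(D_c(T))`: the excess kinetic energy of the speed
above an admissible level at any instant is controlled by the geometric mean of (`M^m ×` the
space–time occupation of the level set) and its speed-gradient energy — a fast excursion cannot be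
both fat and brief. A consequence of the crux (`½∫(|u(t)|−c)₊² ≤ PW_c(t)`). Why it might fail: a
pressure-driven "flash" (a fat blob carrying a fixed fraction of `E₀` accelerated to speed `M` and
decelerated within `O(M^{m/2−2})` turnover times) — only at unbounded amplification, i.e. the
blow-up regime. -/
theorem stub_kineticLevelSetLaw :
    ∀ (ν T : ℝ), 0 < ν → 0 < T → ∃ m₀ : ℝ, m₀ < 10 / 3 ∧ ∀ m : ℝ, m₀ ≤ m → m < 10 / 3 →
      ∃ F : ℝ → ℝ → ℝ,
      ∀ (u : ℝ → EuclideanSpace ℝ (Fin 3) → EuclideanSpace ℝ (Fin 3))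
        (p : ℝ → EuclideanSpace ℝ (Fin 3) → ℝ),
        Literature.Analysis.FluidPDE.IsClassicalNSSolutionOn (Set.Ico 0 T) ν 0 u p →
        Literature.Analysis.FluidPDE.IsLerayHopfOn T ν 0 (u 0) u →
        Literature.Analysis.FluidPDE.HasRapidSpatialDecay (u 0) →
        ∀ (E₀ B₀ : ℝ), (∫ x, ‖u 0 x‖ ^ 2) ≤ E₀ → (∀ x, ‖u 0 x‖ ≤ B₀) →
        ∀ (M c t : ℝ), 2 * B₀ ≤ M → M / 2 ≤ c → c ≤ M → 0 < c → t ∈ Set.Ico 0 T →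
        1 / 2 * (∫ x, (max (‖u t x‖ - c) 0) ^ 2) ≤
          Real.sqrt (F E₀ B₀ * M ^ m *
              (∫⁻ τ in Set.Ioo 0 T, volume {x | c < ‖u τ x‖}).toReal) / 2 *
            Real.sqrt ((∫⁻ τ in Set.Ioo 0 T, ∫⁻ x, Set.indicator {x | c < ‖u τ x‖}
              (fun x => ENNReal.ofReal (‖fderiv ℝ (fun y => ‖u τ y‖) x‖ ^ 2)) x).toReal) := by
  sorry

/-- **The crux BY NAME from the three stubs** (sorries live only in `stub_*`): the two halves at the
common exponent `m = max m₁ m₂ < 10/3` with modulus `max (F₁, F₂, 0)`, added under the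
pressure-free bound. -/
theorem HighSpeedPressureWork_of :
    Summit.NavierStokesRegularity.NavierStokesRegularity.Theses.LevelSetModeration.HighSpeedPressureWork := by
  intro ν T hν hT
  obtain ⟨m₁, hm₁, H₁⟩ := stub_viscousLevelSetLaw ν T hν hT
  obtain ⟨m₂, hm₂, H₂⟩ := stub_kineticLevelSetLaw ν T hν hT
  have hm : max m₁ m₂ < 10 / 3 := max_lt hm₁ hm₂
  obtain ⟨F₁, hF₁⟩ := H₁ (max m₁ m₂) (le_max_left _ _) hm
  obtain ⟨F₂, hF₂⟩ := H₂ (max m₁ m₂) (le_max_right _ _) hm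
  refine ⟨max m₁ m₂, hm, fun E₀ B₀ => max (max (F₁ E₀ B₀) (F₂ E₀ B₀)) 0, ?_⟩
  intro u p hcl hLH hdec E₀ B₀ hE hB M c t hM hMc hcM hc ht
  -- abbreviations for the route's level-set quantities
  set m : ℝ := max m₁ m₂ with hmdef
  set V : ℝ := (∫⁻ τ in Set.Ioo 0 T, volume {x | c < ‖u τ x‖}).toReal with hV
  set D : ℝ := (∫⁻ τ in Set.Ioo 0 T, ∫⁻ x, Set.indicator {x | c < ‖u τ x‖}
      (fun x => ENNReal.ofReal (‖fderiv ℝ (fun y => ‖u τ y‖) x‖ ^ 2)) x).toReal with hD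
  set Dt : ℝ := (∫⁻ τ in Set.Ioo 0 t, ∫⁻ x, Set.indicator {x | c < ‖u τ x‖}
      (fun x => ENNReal.ofReal (c / ‖u τ x‖ * ‖fderiv ℝ (fun y => ‖u τ y‖) x‖ ^ 2 +
        (1 - c / ‖u τ x‖) *
          Literature.Analysis.FluidPDE.frobeniusNormSq (fderiv ℝ (u τ) x))) x).toReal with hDt
  set E : ℝ := ∫ x, (max (‖u t x‖ - c) 0) ^ 2 with hEdef
  set G : ℝ := max (max (F₁ E₀ B₀) (F₂ E₀ B₀)) 0 with hG
  -- the three stubs on this event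
  have hcB : ∀ x, ‖u 0 x‖ ≤ c := fun x => (hB x).trans (by linarith)
  have h0 : -(∫ τ in Set.Ioo 0 t, ∫ x, max (1 - c / ‖u τ x‖) 0 *
      (fderiv ℝ (Literature.Analysis.FluidPDE.normalisedPressure (u τ)) x (u τ x))) ≤
      1 / 2 * E + ν * Dt :=
    stub_pressureFreeBound ν T u p hν hT hcl hLH hdec c hc hcB t ht
  have h1 : ν * Dt ≤ Real.sqrt (F₁ E₀ B₀ * M ^ m * V) / 2 * Real.sqrt D :=
    hF₁ u p hcl hLH hdec E₀ B₀ hE hB M c t hM hMc hcM hc ht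
  have h2 : 1 / 2 * E ≤ Real.sqrt (F₂ E₀ B₀ * M ^ m * V) / 2 * Real.sqrt D :=
    hF₂ u p hcl hLH hdec E₀ B₀ hE hB M c t hM hMc hcM hc ht
  -- signs and monotonicity of the modulus
  have hM0 : 0 ≤ M := hc.le.trans hcM
  have hMm : 0 ≤ M ^ m := Real.rpow_nonneg hM0 m
  have hV0 : 0 ≤ V := ENNReal.toReal_nonneg
  have hsD : 0 ≤ Real.sqrt D := Real.sqrt_nonneg _
  have hF₁G : F₁ E₀ B₀ ≤ G := (le_max_left _ _).trans (le_max_left _ _)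
  have hF₂G : F₂ E₀ B₀ ≤ G := (le_max_right _ _).trans (le_max_left _ _)
  have hs₁ : Real.sqrt (F₁ E₀ B₀ * M ^ m * V) ≤ Real.sqrt (G * M ^ m * V) :=
    Real.sqrt_le_sqrt (mul_le_mul_of_nonneg_right (mul_le_mul_of_nonneg_right hF₁G hMm) hV0)
  have hs₂ : Real.sqrt (F₂ E₀ B₀ * M ^ m * V) ≤ Real.sqrt (G * M ^ m * V) :=
    Real.sqrt_le_sqrt (mul_le_mul_of_nonneg_right (mul_le_mul_of_nonneg_right hF₂G hMm) hV0)
  have h1' : ν * Dt ≤ Real.sqrt (G * M ^ m * V) / 2 * Real.sqrt D :=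
    h1.trans (mul_le_mul_of_nonneg_right (div_le_div_of_nonneg_right hs₁ (by norm_num)) hsD)
  have h2' : 1 / 2 * E ≤ Real.sqrt (G * M ^ m * V) / 2 * Real.sqrt D :=
    h2.trans (mul_le_mul_of_nonneg_right (div_le_div_of_nonneg_right hs₂ (by norm_num)) hsD)
  calc -(∫ τ in Set.Ioo 0 t, ∫ x, max (1 - c / ‖u τ x‖) 0 *
          (fderiv ℝ (Literature.Analysis.FluidPDE.normalisedPressure (u τ)) x (u τ x)))
        ≤ 1 / 2 * E + ν * Dt := h0
    _ ≤ Real.sqrt (G * M ^ m * V) / 2 * Real.sqrt D +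
          Real.sqrt (G * M ^ m * V) / 2 * Real.sqrt D := add_le_add h2' h1'
    _ = Real.sqrt (G * M ^ m * V) * Real.sqrt D := by ring

end Summit.NavierStokesRegularity.NavierStokesRegularity.Cruxes.HighSpeedPressureWork.PressureFreeSplit

end
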